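import Mathlib
import Summits.ResolutionOfSingularities.ResolutionOfSingularities.Theorems.WildQuotientsWildQuotientResolutionJordanFiveChartW2RangeConversion
import Summits.ResolutionOfSingularities.ResolutionOfSingularities.Theorems.WildQuotientsWildQuotientResolutionJordanFiveRingBrickTwoModel
import Summits.ResolutionOfSingularities.ResolutionOfSingularities.Theorems.WildQuotientsWildQuotientResolutionJordanFiveMu2CoverDefs
import Summits.ResolutionOfSingularities.ResolutionOfSingularities.Theorems.WildQuotientsWildQuotientResolutionJordanFiveMu2CoverKL
import Summits.ResolutionOfSingularities.ResolutionOfSingularities.Theorems.WildQuotientsWildQuotientResolutionJordanFiveMu2CoverIrreducible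
import Summits.ResolutionOfSingularities.ResolutionOfSingularities.Theorems.WildQuotientsWildQuotientResolutionJordanFiveMu2CoverDescent
import Summits.ResolutionOfSingularities.ResolutionOfSingularities.Theorems.WildQuotientsWildQuotientResolutionJordanFiveMu2CoverInvariantsRegular
import Summits.ResolutionOfSingularities.ResolutionOfSingularities.Theorems.WildQuotientsWildQuotientResolutionJordanFiveMu2CoverSubstDefs
import Summits.ResolutionOfSingularities.ResolutionOfSingularities.Theorems.WildQuotientsWildQuotientResolutionJordanFiveMu2CoverSubst
import Summits.ResolutionOfSingularities.ResolutionOfSingularities.Theorems.WildQuotientsWildQuotientResolutionJordanFiveCoverInjective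
import Summits.ResolutionOfSingularities.ResolutionOfSingularities.Theorems.WildQuotientsWildQuotientResolutionJordanFiveChartW2CoverModel

/-!
# RUNG V5 (`J₅`), brick B7/HP₂ — F3: the ring side `Hring` of `H₂` on `B_{W₂}` (assembly)

(crux stmt-ResolutionOfSingularities-15640 `WildQuotients.WildQuotientResolution`, line `Sketch`,
sector `|G| = p`; RUNG V5 of `L/w45c/CHAIN.md` v8.5, brick B7/`HP₂`; res-L1-w45c-plan-1
RE-ALLOCATION 2026-08-27T14:44:41Z (y) / «(y) FIRED» 14:53:44Z: stub-3 writes F3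
`JordanFive.exists_ringBrick_HP2_chartW₂` = the `Hring` binder of res-L1-w45c-stub-5's
`JordanFive.brickH₂_of_ringSide` (p537070) VERBATIM, assembled from res-type-036's model brick
`exists_ringBrick_HP2_model` (p540201), res-L1-w45c-lead-1's range conversion
`chartW₂_coverFixed_iff` (p539462) and stub-5's (W₂-A) ring isomorphism
`exists_chartW₂_away_ringEquiv_fixedTau` (p542167). [OURS · L1 W4.5c] — assembly of landed decls; NOT a
statement of any manuscript. Prover res-L1-w45c-stub-3.)

* **`JordanFive.exists_ringBrick_HP2_chartW₂`** — `Hring`; the non-zero-divisor input of the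
  range conversion is res-L1-w45c-stub-5's `coverSubst_algebraMap_iTwo_jThreeTwo_ne_zero`
  (`…JordanFiveCoverInjective`).
-/

-- single-problem summit: the doubled namespace component `ResolutionOfSingularities` is forced
set_option linter.dupNamespace false

noncomputable section

open MvPolynomial Polynomial HomogeneousLocalization AlgebraicGeometry
open Literature.AlgebraicGeometry.Resolution

namespace Summit.ResolutionOfSingularities.ResolutionOfSingularities.Theorems.WildQuotientResolution.JordanFive

-- the statement is the literal `Hring` binder of p537070 (large homogeneous-localisation terms,
-- as in p537070 / p540201): elaboration needs head-room
set_option maxHeartbeats 1600000 in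
/-- **F3 — the ring side `Hring` of the brick `H₂` on `B_{W₂} = (k[x][I₁₂t])_{(i₂³t·(2j₃)²t)}`**
(the hypothesis `Hring` of `brickH₂_of_ringSide`, p537070, VERBATIM): for every graded family `φ`
with the coefficient law, its powers clause `hP` at `s₂`, and ratios `t_j` with `(i₂³/1)·t_j = g_j/1`,
there are `R₀`, a radical `J₀` with `Bl_{J₀}` regular and an injective `ψC : R₀ → B_{W₂}` onto the
`φ`-fixed part with `√(ψC⁻¹⟨x_a/1,…,x_d/1, t_j⟩) = J₀`. Assembly: the twisted-root cover
`U₂ = (k[s,Y,pass] ⧸ (Φ))[1/î]` with its cover action `σ_U` and deck involution `τ_U`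
(`exists_coverSigma_away`, `exists_coverTau_away`), the (W₂-A) ring isomorphism
`B_{W₂} ≃ U₂^{τ_U}` over `π ∘ coverSubst`, res-type-036's model brick `exists_ringBrick_HP2_model`
and res-L1-w45c-lead-1's range conversion `chartW₂_coverFixed_iff`.
[OURS · L1 W4.5c; res-L1-w45c-plan-1 14:53:44Z (y)] [folklore; assembly of landed decls] -/
theorem exists_ringBrick_HP2_chartW₂ (p : ℕ) (hp : p.Prime) (hp5 : 5 ≤ p)
    (k : Type) [Field k] [CharP k p] (n : ℕ)
    (σ : MvPolynomial (Fin n) k ≃ₐ[k] MvPolynomial (Fin n) k) [Finite ↥(Subgroup.zpowers σ)]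
    (a b c d e : Fin n) (hab : a ≠ b) (hac : a ≠ c) (had : a ≠ d) (hae : a ≠ e) (hbc : b ≠ c)
    (hbd : b ≠ d) (hbe : b ≠ e) (hcd : c ≠ d) (hce : c ≠ e) (hde : d ≠ e)
    (hb : σ (X b) = X b + X a) (hc : σ (X c) = X c + X b) (hd : σ (X d) = X d + X c)
    (he : σ (X e) = X e + X d)
    (hσ : ∀ i, i ≠ b → i ≠ c → i ≠ d → i ≠ e → σ (X i) = X i) :
    ∀ (φ : ↥(Subgroup.zpowers σ) → (reesGrading (I12 k n a b c d) →+*ᵍ reesGrading (I12 k n a b c d)))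
      (_ : ∀ (g : ↥(Subgroup.zpowers σ)) x, ((φ g x : reesAlgebra (I12 k n a b c d)) :
          (MvPolynomial (Fin n) k)[X]) =
        (x : (MvPolynomial (Fin n) k)[X]).map ((MulSemiringAction.toRingEquiv
          (↥(Subgroup.zpowers σ)) (MvPolynomial (Fin n) k) g⁻¹ : _ ≃+* _) : _ →+* _))
      (hP : ∀ g, Submonoid.powers (reesT (iTwo k n a b c d e ^ 3) (iTwo_cube_mem_I12 k n a b c d e) *
          reesT (jThreeTwo k n a b c d e ^ 2) (jThreeTwo_sq_mem_I12 k n a b c d e)) ≤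
        (Submonoid.powers (reesT (iTwo k n a b c d e ^ 3) (iTwo_cube_mem_I12 k n a b c d e) *
          reesT (jThreeTwo k n a b c d e ^ 2) (jThreeTwo_sq_mem_I12 k n a b c d e))).comap (φ g))
      (t : {j : Fin 40 // j ≠ 0 ∧ j ≠ 2 ∧ j ≠ 5 ∧ j ≠ 13} →
        HomogeneousLocalization.Away (reesGrading (I12 k n a b c d))
          (reesT (iTwo k n a b c d e ^ 3) (iTwo_cube_mem_I12 k n a b c d e) *
            reesT (jThreeTwo k n a b c d e ^ 2) (jThreeTwo_sq_mem_I12 k n a b c d e)))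
      (_ : ∀ j, ((fromZeroRingHom (reesGrading (I12 k n a b c d)) (.powers _)).comp
          (reesGrading.zeroRingHom (I12 k n a b c d))) (iTwo k n a b c d e ^ 3) * t j =
        ((fromZeroRingHom (reesGrading (I12 k n a b c d)) (.powers _)).comp
          (reesGrading.zeroRingHom (I12 k n a b c d))) (gens12 k n a b c d j.1)),
      ∃ (R₀ : Type) (_ : CommRing R₀) (J₀ : Ideal R₀)
        (ψC : R₀ →+* HomogeneousLocalization.Away (reesGrading (I12 k n a b c d))
          (reesT (iTwo k n a b c d e ^ 3) (iTwo_cube_mem_I12 k n a b c d e) *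
            reesT (jThreeTwo k n a b c d e ^ 2) (jThreeTwo_sq_mem_I12 k n a b c d e))),
        Function.Injective ψC ∧
        (∀ y, y ∈ Set.range ψC ↔ ∀ g, HomogeneousLocalization.map (φ g) (hP g) y = y) ∧
        J₀.IsRadical ∧ Scheme.IsRegular (affineBlowup J₀) ∧
        ((Ideal.span (((fromZeroRingHom (reesGrading (I12 k n a b c d)) (.powers _)).comp
          (reesGrading.zeroRingHom (I12 k n a b c d))) '' {X a, X b, X c, X d} ∪ Set.range t)).comap
          ψC).radical = J₀ := by
  intro φ hφ hP t ht
  classical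
  have h2k : (2 : k) ≠ 0 := two_ne_zero_of_five_le k p hp hp5
  have h3k : (3 : k) ≠ 0 := three_ne_zero_of_five_le k p hp hp5
  -- the cover `U₂ = (k[s,Y,pass] ⧸ (Φ))[1/î]` with its two automorphisms
  obtain ⟨I, hI⟩ : ∃ I : Ideal (MvPolynomial (Option (Fin n)) k),
      I = Ideal.span {coverPhi (X none) (X (some a)) (X (some b)) (X (some c)) (X (some d))
        (X (some e) : MvPolynomial (Option (Fin n)) k)} := ⟨_, rfl⟩
  obtain ⟨ι, hι⟩ : ∃ ι : MvPolynomial (Option (Fin n)) k,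
      ι = coverIHat (X none) (X (some a)) (X (some b)) (X (some c)) (X (some d)) (X (some e)) :=
    ⟨_, rfl⟩
  obtain ⟨σU, hs, h1, h2, h3, h4, hσU⟩ :=
    exists_coverSigma_away k n a b c d e hab hac had hae hbc hbd hbe hcd hce hde I ι hI hι
  obtain ⟨τU, τs, τb, τd, τi, -⟩ :=
    exists_coverTau_away k n a b c d e hab had hbc hbe hcd hde I ι hI hι
  haveI : IsDomain (MvPolynomial (Option (Fin n)) k ⧸ I) := by
    rw [hI]; exact isDomain_quotient_coverPhi k n a b c d e hab hac hae hbc hbe hce hde h2k h3k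
  haveI : IsDomain (Localization.Away (Ideal.Quotient.mk I ι)) :=
    away_quotient_isDomain k n I ι _ (by
      rw [hI, hι]; exact coverIHat_notMem_span_coverPhi k n a b c d e hac hbc hcd hce)
  -- (W₂-A): the chart ring is the ring of `τ_U`-invariants
  obtain ⟨eE, hbase⟩ := exists_chartW₂_away_ringEquiv_fixedTau k n a b c d e hab hac had hae hbc hbd hbe
    hcd hce hde I ι hI hι (Localization.Away (Ideal.Quotient.mk I ι)) h2k h3k τU τs τb τd τi
  -- res-type-036's model brick
  obtain ⟨R₀, instR₀, J₀, ψC, hinj, hrange, hrad, hreg, hJ⟩ :=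
    exists_ringBrick_HP2_model k n a b c d e hab hac had hae hbc hbd hbe hcd hce hde I ι hI hι
      (Localization.Away (Ideal.Quotient.mk I ι)) hp hp5 σU hs h1 h2 h3 h4 hσU τU τs τb τd τi
      ((fromZeroRingHom (reesGrading (I12 k n a b c d)) (.powers _)).comp
        (reesGrading.zeroRingHom (I12 k n a b c d))) eE hbase t ht
  refine ⟨R₀, instR₀, J₀, ψC, hinj, fun y => ?_, hrad, hreg, hJ⟩
  rw [hrange y]
  -- res-L1-w45c-lead-1's range conversion
  exact chartW₂_coverFixed_iff k n a b c d e σ hab hac had hae hb hc hd he hσ φ hφ hP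
    (FixedPoints.subalgebra k (Localization.Away (Ideal.Quotient.mk I ι)) (Subgroup.zpowers τU))
    eE σU (fun F => algebraMap _ _ (Ideal.Quotient.mk I (coverSubst k n a b c d F))) hbase
    (cover_apply_algebraMap_coverSubst k n a b c d e hab hac had hae hbc hbd hbe hcd hce hde I
      (Localization.Away (Ideal.Quotient.mk I ι)) σ hb hc hd he hσ σU hs h1 h2 h3 h4 hσU)
    (mem_nonZeroDivisors_of_ne_zero (by
      rw [map_mul, map_mul, map_mul]
      exact coverSubst_algebraMap_iTwo_jThreeTwo_ne_zero k n a b c d e hab hac had hae hbc hbd hbe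
        hcd hce hde I ι hI hι (Localization.Away (Ideal.Quotient.mk I ι)) h2k h3k))
    y

end Summit.ResolutionOfSingularities.ResolutionOfSingularities.Theorems.WildQuotientResolution.JordanFive

end
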